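import Literature.NumberTheory.CubicFields.PureCubicEmbeddingValues
import Literature.Computability.Complexity.NatCbrtFP
import HarnessLib

/-!
# The rounded embedding matrix of the program `lexE`: accuracy

Topic `NumberTheory/CubicFields`, sub-namespace `PureCubicLexMin`. The first stage of `perScale`
(`PureCubicLexMinProgram.lean`) evaluates the register expressions `btExprs` on
`regs0 = [a, b, den, h11, …, h33, s, N, T1, T2, S3]`, `T1 = ⌊2ᴺ∛(ab²)⌋`, `T2 = ⌊2ᴺ∛(a²b)⌋`,
`S3 = ⌊2ᴺ√3⌋`, producing an integer `3 × 3` matrix `B̃` (row-major). PROVED here: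

* `bt_eq` : the closed form of the nine entries (symbolic execution of `btExprs`);
* `cast_ediv_sub_div_lt` (`|⌊n/d⌋ − n/d| < 1`), `scaledCbrt_bounds` (`0 ≤ 2ᴺ t − ⌊2ᴺ t⌋ < 1` for the
  two cube roots), `scaledSqrt3_bounds`;
* `col1_err`, `col1_err_neg`, `col2_err`, `col3_err` : entrywise accuracy of one rounded row;
* **`bt_approx`** : `|B̃ᵢⱼ − 2ᴺ (B_X)ᵢⱼ| ≤ 6 · 2^{|s|} · h · ab` for `X = 2ˢ`, `|hᵢⱼ| ≤ h`, `1 ≤ h`,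
  `|s| ≤ N`, where `B_X = embMatrix (t1 a b) (t2 a b) (2^s) den [h11, …, h33]`.

## References

* H. Cohen, *A Course in Computational Algebraic Number Theory*, GTM 138 (1993), §6.5 (working
  precision of the real embeddings). [Cohen1993]
-/

noncomputable section

namespace Literature.NumberTheory.CubicFields

namespace PureCubicLexMin

open Literature.Computability.Complexity Literature.Computability.Complexity.RegProg
  Literature.Computability.Complexity.CodeFP

/-! ### Symbolic execution of `btExprs` -/

/-- **The nine entries of `B̃`** on the initial register file (with `|s| ≤ N`). [folklore] -/
theorem bt_eq (a b den : ℕ) (h11 h12 h13 h22 h23 h33 : ℤ) (N : ℕ) (s : ℤ) (hsN : s.natAbs ≤ N) :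
    btExprs.map (Ex.eval N (regs0 ((a, b), (den, [h11, h12, h13, h22, h23, h33])) N s)) =
      [ (if 0 ≤ s then ((h11 : ℤ) * 2 ^ N + h12 * (Nat.nthRoot 3 (a * b ^ 2 * 8 ^ N) : ℤ) +
            h13 * (Nat.nthRoot 3 (a ^ 2 * b * 8 ^ N) : ℤ)) / ((den : ℤ) * 2 ^ s.natAbs)
         else ((h11 : ℤ) * 2 ^ N + h12 * (Nat.nthRoot 3 (a * b ^ 2 * 8 ^ N) : ℤ) +
            h13 * (Nat.nthRoot 3 (a ^ 2 * b * 8 ^ N) : ℤ)) * 2 ^ s.natAbs / (den : ℤ)),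
        (2 * ((h11 : ℤ) * 2 ^ N) - h12 * (Nat.nthRoot 3 (a * b ^ 2 * 8 ^ N) : ℤ) -
            h13 * (Nat.nthRoot 3 (a ^ 2 * b * 8 ^ N) : ℤ)) / (2 * (den : ℤ)),
        (Nat.sqrt (3 * 4 ^ N) : ℤ) * (h12 * (Nat.nthRoot 3 (a * b ^ 2 * 8 ^ N) : ℤ) -
            h13 * (Nat.nthRoot 3 (a ^ 2 * b * 8 ^ N) : ℤ)) / (2 * (den : ℤ) * 2 ^ N),
        (if 0 ≤ s then ((0 : ℤ) * 2 ^ N + h22 * (Nat.nthRoot 3 (a * b ^ 2 * 8 ^ N) : ℤ) +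
            h23 * (Nat.nthRoot 3 (a ^ 2 * b * 8 ^ N) : ℤ)) / ((den : ℤ) * 2 ^ s.natAbs)
         else ((0 : ℤ) * 2 ^ N + h22 * (Nat.nthRoot 3 (a * b ^ 2 * 8 ^ N) : ℤ) +
            h23 * (Nat.nthRoot 3 (a ^ 2 * b * 8 ^ N) : ℤ)) * 2 ^ s.natAbs / (den : ℤ)),
        (2 * ((0 : ℤ) * 2 ^ N) - h22 * (Nat.nthRoot 3 (a * b ^ 2 * 8 ^ N) : ℤ) -
            h23 * (Nat.nthRoot 3 (a ^ 2 * b * 8 ^ N) : ℤ)) / (2 * (den : ℤ)),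
        (Nat.sqrt (3 * 4 ^ N) : ℤ) * (h22 * (Nat.nthRoot 3 (a * b ^ 2 * 8 ^ N) : ℤ) -
            h23 * (Nat.nthRoot 3 (a ^ 2 * b * 8 ^ N) : ℤ)) / (2 * (den : ℤ) * 2 ^ N),
        (if 0 ≤ s then ((0 : ℤ) * 2 ^ N + 0 * (Nat.nthRoot 3 (a * b ^ 2 * 8 ^ N) : ℤ) +
            h33 * (Nat.nthRoot 3 (a ^ 2 * b * 8 ^ N) : ℤ)) / ((den : ℤ) * 2 ^ s.natAbs)
         else ((0 : ℤ) * 2 ^ N + 0 * (Nat.nthRoot 3 (a * b ^ 2 * 8 ^ N) : ℤ) +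
            h33 * (Nat.nthRoot 3 (a ^ 2 * b * 8 ^ N) : ℤ)) * 2 ^ s.natAbs / (den : ℤ)),
        (2 * ((0 : ℤ) * 2 ^ N) - 0 * (Nat.nthRoot 3 (a * b ^ 2 * 8 ^ N) : ℤ) -
            h33 * (Nat.nthRoot 3 (a ^ 2 * b * 8 ^ N) : ℤ)) / (2 * (den : ℤ)),
        (Nat.sqrt (3 * 4 ^ N) : ℤ) * (0 * (Nat.nthRoot 3 (a * b ^ 2 * 8 ^ N) : ℤ) -
            h33 * (Nat.nthRoot 3 (a ^ 2 * b * 8 ^ N) : ℤ)) / (2 * (den : ℤ) * 2 ^ N) ] := by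
  have hmin : min (|s|).toNat N = s.natAbs := by
    have : (|s|).toNat = s.natAbs := by
      apply Int.ofNat.inj
      simp only [Int.ofNat_eq_natCast, Int.natCast_natAbs, Int.toNat_of_nonneg (abs_nonneg s)]
    rw [this, min_eq_left hsN]
  simp [btExprs, rowExprs, col1, col2, col3, linA, powN, powS, Ex.eval, regs0, hmin]

/-! ### Elementary accuracy lemmas -/

/-- **Integer division is a floor**: `|⌊n/d⌋ − n/d| < 1` read in `ℝ` (`d ≥ 1`). [folklore] -/
theorem cast_ediv_sub_div_lt (n : ℤ) (d : ℕ) :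
    |((n / (d : ℤ) : ℤ) : ℝ) - (n : ℝ) / d| < 1 := by
  have hfl : n / (d : ℤ) = ⌊(n : ℝ) / d⌋ := by
    rw [show (n : ℝ) / d = ((n / d : ℚ) : ℝ) by push_cast; rfl, Rat.floor_cast,
      Rat.floor_intCast_div_natCast]
  rw [hfl, abs_sub_lt_iff]
  constructor <;> linarith [Int.floor_le ((n : ℝ) / d), Int.lt_floor_add_one ((n : ℝ) / d)]

/-- **Floor of an approximate numerator**: if `|A − τ D| ≤ E` then `|⌊A / D⌋ − τ| < 1 + E / D`.
[folklore] -/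
theorem cast_ediv_sub_lt_of_abs_sub_le (A : ℤ) {D : ℕ} (hD : 0 < D) {τ E : ℝ}
    (h : |(A : ℝ) - τ * D| ≤ E) : |((A / (D : ℤ) : ℤ) : ℝ) - τ| < 1 + E / D := by
  have hD' : (0 : ℝ) < D := by exact_mod_cast hD
  have h1 := cast_ediv_sub_div_lt A D
  have h2 : |(A : ℝ) / D - τ| ≤ E / D := by
    rw [show (A : ℝ) / D - τ = ((A : ℝ) - τ * D) / D by field_simp, abs_div, abs_of_pos hD']
    exact div_le_div_of_nonneg_right h hD'.le
  calc |((A / (D : ℤ) : ℤ) : ℝ) - τ| = |(((A / (D : ℤ) : ℤ) : ℝ) - (A : ℝ) / D) + ((A : ℝ) / D - τ)| := by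
        ring_nf
    _ ≤ |((A / (D : ℤ) : ℤ) : ℝ) - (A : ℝ) / D| + |(A : ℝ) / D - τ| := abs_add_le _ _
    _ < 1 + E / D := by linarith

/-- `∛(m · 8ᴺ) = 2ᴺ ∛m`. [folklore] -/
theorem rpow_third_mul_eight_pow (m N : ℕ) :
    (((m * 8 ^ N : ℕ)) : ℝ) ^ (1 / 3 : ℝ) = (m : ℝ) ^ (1 / 3 : ℝ) * 2 ^ N := by
  have h8 : ((8 : ℝ) ^ N) = ((2 : ℝ) ^ N) ^ (3 : ℕ) := by rw [← pow_mul, mul_comm, pow_mul]; norm_num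
  push_cast
  rw [Real.mul_rpow (Nat.cast_nonneg m) (by positivity), h8, ← Real.rpow_natCast,
    ← Real.rpow_mul (by positivity), show ((3 : ℕ) : ℝ) * (1 / 3) = 1 by norm_num, Real.rpow_one]

/-- **The scaled integer cube root**: `⌊∛(m 8ᴺ)⌋ ≤ 2ᴺ ∛m < ⌊∛(m 8ᴺ)⌋ + 1`. [folklore] -/
theorem nthRoot_scaled_bounds (m N : ℕ) :
    (Nat.nthRoot 3 (m * 8 ^ N) : ℝ) ≤ (m : ℝ) ^ (1 / 3 : ℝ) * 2 ^ N ∧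
      (m : ℝ) ^ (1 / 3 : ℝ) * 2 ^ N < Nat.nthRoot 3 (m * 8 ^ N) + 1 := by
  have h := nthRoot_three_le_rpow_and_lt (m * 8 ^ N)
  rwa [rpow_third_mul_eight_pow] at h

/-- **The scaled integer square root of `3`**: `⌊√(3·4ᴺ)⌋ ≤ 2ᴺ √3 < ⌊√(3·4ᴺ)⌋ + 1`. [folklore] -/
theorem sqrt_three_scaled_bounds (N : ℕ) :
    (Nat.sqrt (3 * 4 ^ N) : ℝ) ≤ Real.sqrt 3 * 2 ^ N ∧ Real.sqrt 3 * 2 ^ N < Nat.sqrt (3 * 4 ^ N) + 1 := by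
  have hsq : Real.sqrt 3 * 2 ^ N = Real.sqrt ((3 * 4 ^ N : ℕ) : ℝ) := by
    push_cast
    rw [show (4 : ℝ) ^ N = (2 ^ N) ^ 2 by rw [← pow_mul, mul_comm, pow_mul]; norm_num,
      Real.sqrt_mul (by norm_num), Real.sqrt_sq (by positivity)]
  rw [hsq]
  constructor
  · rw [Real.le_sqrt (by positivity) (by positivity)]
    exact_mod_cast Nat.sqrt_le' (3 * 4 ^ N)
  · rw [Real.sqrt_lt' (by positivity)]
    exact_mod_cast Nat.lt_succ_sqrt' (3 * 4 ^ N)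

/-! ### Accuracy of one rounded row -/

section Row

variable {t₁ t₂ : ℝ} {N : ℕ} {T1 T2 S3 : ℤ}
  (hT1 : (T1 : ℝ) ≤ t₁ * 2 ^ N ∧ t₁ * 2 ^ N < T1 + 1) (hT2 : (T2 : ℝ) ≤ t₂ * 2 ^ N ∧ t₂ * 2 ^ N < T2 + 1)
include hT1 hT2

/-- `|x 2ᴺ + y T1 + z T2 − 2ᴺ (x + y t₁ + z t₂)| ≤ |y| + |z|`. [folklore] -/
theorem linA_err (x y z : ℤ) :
    |((x * 2 ^ N + y * T1 + z * T2 : ℤ) : ℝ) - 2 ^ N * (x + y * t₁ + z * t₂)| ≤ |(y : ℝ)| + |(z : ℝ)| := by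
  have e1 : |(y : ℝ) * (T1 - t₁ * 2 ^ N)| ≤ |(y : ℝ)| := by
    rw [abs_mul]; refine mul_le_of_le_one_right (abs_nonneg _) ?_
    rw [abs_le]; constructor <;> linarith [hT1.1, hT1.2]
  have e2 : |(z : ℝ) * (T2 - t₂ * 2 ^ N)| ≤ |(z : ℝ)| := by
    rw [abs_mul]; refine mul_le_of_le_one_right (abs_nonneg _) ?_
    rw [abs_le]; constructor <;> linarith [hT2.1, hT2.2]
  push_cast
  calc |(x : ℝ) * 2 ^ N + y * T1 + z * T2 - 2 ^ N * (x + y * t₁ + z * t₂)|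
      = |(y : ℝ) * (T1 - t₁ * 2 ^ N) + z * (T2 - t₂ * 2 ^ N)| := by ring_nf
    _ ≤ |(y : ℝ) * (T1 - t₁ * 2 ^ N)| + |(z : ℝ) * (T2 - t₂ * 2 ^ N)| := abs_add_le _ _
    _ ≤ |(y : ℝ)| + |(z : ℝ)| := add_le_add e1 e2

/-- **First column, `s ≥ 0`**: `|⌊A / (den 2ᵏ)⌋ − 2ᴺ (x + yt₁ + zt₂)/(den 2ᵏ)| < 1 + |y| + |z|`. [folklore] -/
theorem col1_err (x y z : ℤ) {den : ℕ} (hden : 0 < den) (k : ℕ) :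
    |(((x * 2 ^ N + y * T1 + z * T2) / ((den : ℤ) * 2 ^ k) : ℤ) : ℝ) -
        2 ^ N * ((x + y * t₁ + z * t₂) / (den * 2 ^ k))| < 1 + (|(y : ℝ)| + |(z : ℝ)|) := by
  have hD : 0 < den * 2 ^ k := by positivity
  have h := linA_err hT1 hT2 x y z
  have key := cast_ediv_sub_lt_of_abs_sub_le (x * 2 ^ N + y * T1 + z * T2) hD
    (τ := 2 ^ N * ((x + y * t₁ + z * t₂) / (den * 2 ^ k))) (E := |(y : ℝ)| + |(z : ℝ)|) (by
      convert h using 2; push_cast; field_simp)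
  rw [show ((den : ℤ) * 2 ^ k) = ((den * 2 ^ k : ℕ) : ℤ) by push_cast; ring]
  refine key.trans_le ?_
  have hD' : (1 : ℝ) ≤ (den * 2 ^ k : ℕ) := by exact_mod_cast hD
  have : (|(y : ℝ)| + |(z : ℝ)|) / ((den * 2 ^ k : ℕ) : ℝ) ≤ |(y : ℝ)| + |(z : ℝ)| :=
    div_le_self (by positivity) hD'
  linarith

/-- **First column, `s < 0`**: `|⌊A 2ᵏ / den⌋ − 2ᴺ (x + yt₁ + zt₂) 2ᵏ / den| < 1 + (|y| + |z|) 2ᵏ`. [folklore] -/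
theorem col1_err_neg (x y z : ℤ) {den : ℕ} (hden : 0 < den) (k : ℕ) :
    |(((x * 2 ^ N + y * T1 + z * T2) * 2 ^ k / (den : ℤ) : ℤ) : ℝ) -
        2 ^ N * ((x + y * t₁ + z * t₂) / (den * (2 ^ k)⁻¹))| < 1 + (|(y : ℝ)| + |(z : ℝ)|) * 2 ^ k := by
  have h := linA_err hT1 hT2 x y z
  have key := cast_ediv_sub_lt_of_abs_sub_le ((x * 2 ^ N + y * T1 + z * T2) * 2 ^ k) hden
    (τ := 2 ^ N * ((x + y * t₁ + z * t₂) / (den * (2 ^ k)⁻¹))) (E := (|(y : ℝ)| + |(z : ℝ)|) * 2 ^ k) (by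
      have hd : (den : ℝ) ≠ 0 := by positivity
      rw [show (((x * 2 ^ N + y * T1 + z * T2) * 2 ^ k : ℤ) : ℝ) -
          2 ^ N * ((x + y * t₁ + z * t₂) / (den * (2 ^ k)⁻¹)) * den =
          ((((x * 2 ^ N + y * T1 + z * T2 : ℤ)) : ℝ) - 2 ^ N * (x + y * t₁ + z * t₂)) * 2 ^ k by
        push_cast; field_simp, abs_mul, abs_of_pos (by positivity : (0 : ℝ) < 2 ^ k)]
      exact mul_le_mul_of_nonneg_right h (by positivity))
  refine key.trans_le ?_
  have hD' : (1 : ℝ) ≤ den := by exact_mod_cast hden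
  have : (|(y : ℝ)| + |(z : ℝ)|) * 2 ^ k / (den : ℝ) ≤ (|(y : ℝ)| + |(z : ℝ)|) * 2 ^ k :=
    div_le_self (by positivity) hD'
  linarith

/-- **Second column**: `|⌊(2x2ᴺ − yT1 − zT2)/(2 den)⌋ − 2ᴺ (x − (yt₁ + zt₂)/2)/den| < 1 + |y| + |z|`.
[folklore] -/
theorem col2_err (x y z : ℤ) {den : ℕ} (hden : 0 < den) :
    |(((2 * (x * 2 ^ N) - y * T1 - z * T2) / (2 * (den : ℤ)) : ℤ) : ℝ) -
        2 ^ N * ((x - (y * t₁ + z * t₂) / 2) / den)| < 1 + (|(y : ℝ)| + |(z : ℝ)|) := by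
  have hD : 0 < 2 * den := by positivity
  have h := linA_err hT1 hT2 (-2 * x) y z
  have key := cast_ediv_sub_lt_of_abs_sub_le (2 * (x * 2 ^ N) - y * T1 - z * T2) hD
    (τ := 2 ^ N * ((x - (y * t₁ + z * t₂) / 2) / den)) (E := |(y : ℝ)| + |(z : ℝ)|) (by
      rw [← abs_neg]
      convert h using 2; push_cast; field_simp; ring)
  rw [show (2 * (den : ℤ)) = ((2 * den : ℕ) : ℤ) by push_cast; ring]
  refine key.trans_le ?_
  have hD' : (1 : ℝ) ≤ (2 * den : ℕ) := by exact_mod_cast hD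
  have : (|(y : ℝ)| + |(z : ℝ)|) / ((2 * den : ℕ) : ℝ) ≤ |(y : ℝ)| + |(z : ℝ)| :=
    div_le_self (by positivity) hD'
  linarith

variable (hS3 : (S3 : ℝ) ≤ Real.sqrt 3 * 2 ^ N ∧ Real.sqrt 3 * 2 ^ N < S3 + 1)
  (ht1 : 0 ≤ t₁) (ht2 : 0 ≤ t₂)
include hS3 ht1 ht2

/-- **Third column**: `|⌊S3 (yT1 − zT2)/(2 den 2ᴺ)⌋ − 2ᴺ (√3/2)(yt₁ − zt₂)/den| <
1 + 2(|y| + |z|) + |y| t₁ + |z| t₂`. [folklore] -/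
theorem col3_err (y z : ℤ) {den : ℕ} (hden : 0 < den) :
    |(((S3 * (y * T1 - z * T2)) / (2 * (den : ℤ) * 2 ^ N) : ℤ) : ℝ) -
        2 ^ N * (Real.sqrt 3 / 2 * (y * t₁ - z * t₂) / den)| <
      1 + (2 * (|(y : ℝ)| + |(z : ℝ)|) + (|(y : ℝ)| * t₁ + |(z : ℝ)| * t₂)) := by
  have hD : 0 < 2 * den * 2 ^ N := by positivity
  have hP : (0 : ℝ) < 2 ^ N := by positivity
  -- the two error terms of the numerator
  have hA : |((y * T1 - z * T2 : ℤ) : ℝ) - 2 ^ N * (y * t₁ - z * t₂)| ≤ |(y : ℝ)| + |(z : ℝ)| := by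
    have := linA_err hT1 hT2 0 y (-z)
    push_cast at this ⊢
    convert this using 2 <;> [ring_nf; rw [abs_neg]]
  have hS0 : (0 : ℝ) ≤ S3 := by
    have : (0 : ℝ) < (S3 : ℝ) + 1 := lt_of_le_of_lt (by positivity) hS3.2
    have h' : (-1 : ℝ) < S3 := by linarith
    have : (-1 : ℤ) < S3 := by exact_mod_cast h'
    exact_mod_cast (show (0 : ℤ) ≤ S3 by omega)
  have hSle : (S3 : ℝ) ≤ 2 * 2 ^ N := by
    have : Real.sqrt 3 ≤ 2 := by
      have := (Real.sqrt_lt' (by norm_num : (0 : ℝ) < 7 / 4)).2 (by norm_num : (3 : ℝ) < (7 / 4) ^ 2)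
      linarith
    nlinarith [hS3.1]
  have hnum : |((S3 * (y * T1 - z * T2) : ℤ) : ℝ) - (2 ^ N * (Real.sqrt 3 / 2 * (y * t₁ - z * t₂) / den)) *
      ((2 * den * 2 ^ N : ℕ) : ℝ)| ≤ 2 ^ N * (2 * (|(y : ℝ)| + |(z : ℝ)|) + (|(y : ℝ)| * t₁ + |(z : ℝ)| * t₂)) := by
    have hd : (den : ℝ) ≠ 0 := by positivity
    have hrw : ((S3 * (y * T1 - z * T2) : ℤ) : ℝ) - (2 ^ N * (Real.sqrt 3 / 2 * (y * t₁ - z * t₂) / den)) *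
        ((2 * den * 2 ^ N : ℕ) : ℝ) =
        (S3 : ℝ) * (((y * T1 - z * T2 : ℤ) : ℝ) - 2 ^ N * (y * t₁ - z * t₂)) +
          ((S3 : ℝ) - Real.sqrt 3 * 2 ^ N) * (2 ^ N * (y * t₁ - z * t₂)) := by
      push_cast; field_simp; ring
    rw [hrw]
    have e1 : |(S3 : ℝ) * (((y * T1 - z * T2 : ℤ) : ℝ) - 2 ^ N * (y * t₁ - z * t₂))| ≤
        2 * 2 ^ N * (|(y : ℝ)| + |(z : ℝ)|) := by
      rw [abs_mul, abs_of_nonneg hS0]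
      exact mul_le_mul hSle hA (abs_nonneg _) (by positivity)
    have e2 : |((S3 : ℝ) - Real.sqrt 3 * 2 ^ N) * (2 ^ N * (y * t₁ - z * t₂))| ≤
        1 * (2 ^ N * (|(y : ℝ)| * t₁ + |(z : ℝ)| * t₂)) := by
      rw [abs_mul]
      refine mul_le_mul ?_ ?_ (abs_nonneg _) zero_le_one
      · rw [abs_le]; constructor <;> linarith [hS3.1, hS3.2]
      · rw [abs_mul, abs_of_pos hP]
        refine mul_le_mul_of_nonneg_left ?_ hP.le
        calc |(y : ℝ) * t₁ - z * t₂| ≤ |(y : ℝ) * t₁| + |(z : ℝ) * t₂| := abs_sub _ _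
          _ = |(y : ℝ)| * t₁ + |(z : ℝ)| * t₂ := by rw [abs_mul, abs_mul, abs_of_nonneg ht1, abs_of_nonneg ht2]
    calc _ ≤ _ := abs_add_le _ _
      _ ≤ 2 * 2 ^ N * (|(y : ℝ)| + |(z : ℝ)|) + 1 * (2 ^ N * (|(y : ℝ)| * t₁ + |(z : ℝ)| * t₂)) := add_le_add e1 e2
      _ = _ := by ring
  have key := cast_ediv_sub_lt_of_abs_sub_le (S3 * (y * T1 - z * T2)) hD hnum
  rw [show (2 * (den : ℤ) * 2 ^ N) = ((2 * den * 2 ^ N : ℕ) : ℤ) by push_cast; ring]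
  refine key.trans_le ?_
  have hfrac : 2 ^ N * (2 * (|(y : ℝ)| + |(z : ℝ)|) + (|(y : ℝ)| * t₁ + |(z : ℝ)| * t₂)) / ((2 * den * 2 ^ N : ℕ) : ℝ) ≤
      2 * (|(y : ℝ)| + |(z : ℝ)|) + (|(y : ℝ)| * t₁ + |(z : ℝ)| * t₂) := by
    rw [div_le_iff₀ (by positivity)]
    have hd1 : (1 : ℝ) ≤ den := by exact_mod_cast hden
    have hE : 0 ≤ 2 * (|(y : ℝ)| + |(z : ℝ)|) + (|(y : ℝ)| * t₁ + |(z : ℝ)| * t₂) := by positivity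
    push_cast
    calc 2 ^ N * (2 * (|(y : ℝ)| + |(z : ℝ)|) + (|(y : ℝ)| * t₁ + |(z : ℝ)| * t₂))
        ≤ 2 ^ N * (2 * (|(y : ℝ)| + |(z : ℝ)|) + (|(y : ℝ)| * t₁ + |(z : ℝ)| * t₂)) * (2 * den) :=
          le_mul_of_one_le_right (by positivity) (by linarith)
      _ = _ := by ring
  linarith

end Row

/-! ### One row, all three columns, against `embRow` -/

section RowBound

variable {t₁ t₂ T h : ℝ} {N : ℕ} {T1 T2 S3 : ℤ}
  (hT1 : (T1 : ℝ) ≤ t₁ * 2 ^ N ∧ t₁ * 2 ^ N < T1 + 1) (hT2 : (T2 : ℝ) ≤ t₂ * 2 ^ N ∧ t₂ * 2 ^ N < T2 + 1)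
  (hS3 : (S3 : ℝ) ≤ Real.sqrt 3 * 2 ^ N ∧ Real.sqrt 3 * 2 ^ N < S3 + 1)
  (ht1 : 0 ≤ t₁) (ht2 : 0 ≤ t₂) (ht1T : t₁ ≤ T) (ht2T : t₂ ≤ T) (hT : 2 ≤ T) (hh : 1 ≤ h)
include hT1 hT2 hS3 ht1 ht2 ht1T ht2T hT hh

/-- **Accuracy of one rounded row** at scale `X = 2ˢ`, `k = |s|`: each of the three entries is
within `6 · 2ᵏ · h · T` of `2ᴺ` times the corresponding entry of `embRow t₁ t₂ (2^s) den x y z`, when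
`|x|, |y|, |z| ≤ h`. [cite: Cohen1993, §6.5] -/
theorem row_err (s : ℤ) {den : ℕ} (hden : 0 < den) (x y z : ℤ) (hy : |(y : ℝ)| ≤ h) (hz : |(z : ℝ)| ≤ h) :
    |(((if 0 ≤ s then (x * 2 ^ N + y * T1 + z * T2) / ((den : ℤ) * 2 ^ s.natAbs)
        else (x * 2 ^ N + y * T1 + z * T2) * 2 ^ s.natAbs / (den : ℤ)) : ℤ) : ℝ) -
        2 ^ N * embRow t₁ t₂ ((2 : ℝ) ^ s) den x y z 0| ≤ 6 * 2 ^ s.natAbs * h * T ∧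
    |((((2 * (x * 2 ^ N) - y * T1 - z * T2) / (2 * (den : ℤ))) : ℤ) : ℝ) -
        2 ^ N * embRow t₁ t₂ ((2 : ℝ) ^ s) den x y z 1| ≤ 6 * 2 ^ s.natAbs * h * T ∧
    |(((S3 * (y * T1 - z * T2) / (2 * (den : ℤ) * 2 ^ N)) : ℤ) : ℝ) -
        2 ^ N * embRow t₁ t₂ ((2 : ℝ) ^ s) den x y z 2| ≤ 6 * 2 ^ s.natAbs * h * T := by
  set k := s.natAbs with hk
  have h2k : (1 : ℝ) ≤ 2 ^ k := one_le_pow₀ (by norm_num)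
  have hyz : |(y : ℝ)| + |(z : ℝ)| ≤ 2 * h := by linarith
  have hhT : 2 * h ≤ h * T := by nlinarith
  have hk2 : h * T ≤ 2 ^ k * (h * T) := le_mul_of_one_le_left (by positivity) h2k
  have hk3 : h ≤ 2 ^ k * h := le_mul_of_one_le_left (by positivity) h2k
  have hP : 6 * 2 ^ k * h * T = 6 * (2 ^ k * (h * T)) := by ring
  have hyzk : (|(y : ℝ)| + |(z : ℝ)|) * 2 ^ k ≤ 2 * (2 ^ k * h) := by nlinarith
  have hk4 : 2 ^ k * h * 2 ≤ 2 ^ k * (h * T) := by nlinarith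
  have hBd1 : 1 + (|(y : ℝ)| + |(z : ℝ)|) ≤ 6 * 2 ^ k * h * T := by rw [hP]; linarith
  have hBd2 : 1 + (|(y : ℝ)| + |(z : ℝ)|) * 2 ^ k ≤ 6 * 2 ^ k * h * T := by rw [hP]; linarith
  have hBd3 : 1 + (2 * (|(y : ℝ)| + |(z : ℝ)|) + (|(y : ℝ)| * t₁ + |(z : ℝ)| * t₂)) ≤ 6 * 2 ^ k * h * T := by
    have e1 : |(y : ℝ)| * t₁ ≤ h * T := mul_le_mul hy ht1T ht1 (by linarith)
    have e2 : |(z : ℝ)| * t₂ ≤ h * T := mul_le_mul hz ht2T ht2 (by linarith)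
    rw [hP]; linarith
  refine ⟨?_, ?_, ?_⟩
  · rcases le_or_gt 0 s with hs | hs
    · rw [if_pos hs]
      have hX : ((2 : ℝ) ^ s) = 2 ^ k := by
        rw [hk, ← zpow_natCast, Int.natCast_natAbs, abs_of_nonneg hs]
      have h1 := col1_err hT1 hT2 x y z hden k
      simp only [embRow, Matrix.cons_val_zero, hX] at h1 ⊢
      exact le_trans h1.le hBd1
    · rw [if_neg (not_le.2 hs)]
      have hX : ((2 : ℝ) ^ s) = (2 ^ k)⁻¹ := by
        rw [hk, ← zpow_natCast, Int.natCast_natAbs, abs_of_neg hs, zpow_neg, inv_inv]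
      have h1 := col1_err_neg hT1 hT2 x y z hden k
      simp only [embRow, Matrix.cons_val_zero, hX] at h1 ⊢
      exact le_trans h1.le hBd2
  · have h1 := col2_err hT1 hT2 x y z hden
    simp only [embRow, Matrix.cons_val_one] at h1 ⊢
    exact le_trans h1.le hBd1
  · have h1 := col3_err hT1 hT2 hS3 ht1 ht2 y z hden
    simp only [embRow, Matrix.cons_val_two, Matrix.tail_cons, Matrix.head_cons] at h1 ⊢
    exact le_trans h1.le hBd3

end RowBound

/-! ### The rounded matrix against `B_X` -/

/-- From the nine entry bounds to the matrix statement. [folklore] -/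
theorem entries_to_matrix (L : List ℤ) (e0 e1 e2 e3 e4 e5 e6 e7 e8 : ℤ) (hL : L = [e0, e1, e2, e3, e4, e5, e6, e7, e8])
    (t₁ t₂ X : ℝ) (den : ℕ) (h11 h12 h13 h22 h23 h33 : ℤ) (P Bd : ℝ)
    (b0 : |(e0 : ℝ) - P * embRow t₁ t₂ X den h11 h12 h13 0| ≤ Bd)
    (b1 : |(e1 : ℝ) - P * embRow t₁ t₂ X den h11 h12 h13 1| ≤ Bd)
    (b2 : |(e2 : ℝ) - P * embRow t₁ t₂ X den h11 h12 h13 2| ≤ Bd)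
    (b3 : |(e3 : ℝ) - P * embRow t₁ t₂ X den 0 h22 h23 0| ≤ Bd)
    (b4 : |(e4 : ℝ) - P * embRow t₁ t₂ X den 0 h22 h23 1| ≤ Bd)
    (b5 : |(e5 : ℝ) - P * embRow t₁ t₂ X den 0 h22 h23 2| ≤ Bd)
    (b6 : |(e6 : ℝ) - P * embRow t₁ t₂ X den 0 0 h33 0| ≤ Bd)
    (b7 : |(e7 : ℝ) - P * embRow t₁ t₂ X den 0 0 h33 1| ≤ Bd)
    (b8 : |(e8 : ℝ) - P * embRow t₁ t₂ X den 0 0 h33 2| ≤ Bd) (i j : Fin 3) :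
    |((L.getD ((i : ℕ) * 3 + j) 0 : ℤ) : ℝ) - P * embMatrix t₁ t₂ X den [h11, h12, h13, h22, h23, h33] i j| ≤ Bd := by
  rw [hL]
  fin_cases i <;> fin_cases j <;> simp [embMatrix] <;> assumption

/-- **Accuracy of the rounded scaled embedding matrix `B̃`**: for `|hᵢⱼ| ≤ h` (`h ≥ 1`), `a, b ≥ 1`,
`ab ≥ 2`, `den ≥ 1` and `|s| ≤ N`, every entry of `B̃ = btExprs.map (eval N regs0)` is within
`6 · 2^{|s|} · h · ab` of `2ᴺ (B_X)ᵢⱼ`, `B_X = embMatrix (t1 a b) (t2 a b) (2^s) den [h11, …, h33]`.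
[cite: Cohen1993, §6.5] -/
theorem bt_approx {a b : ℕ} (ha : 1 ≤ a) (hb : 1 ≤ b) (hab2 : 2 ≤ a * b) {den : ℕ} (hden : 0 < den)
    (h11 h12 h13 h22 h23 h33 : ℤ) {h : ℝ} (hh : 1 ≤ h)
    (b12 : |(h12 : ℝ)| ≤ h) (b13 : |(h13 : ℝ)| ≤ h) (b22 : |(h22 : ℝ)| ≤ h) (b23 : |(h23 : ℝ)| ≤ h)
    (b33 : |(h33 : ℝ)| ≤ h) (N : ℕ) (s : ℤ) (hsN : s.natAbs ≤ N) (i j : Fin 3) :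
    |(((btExprs.map (Ex.eval N (regs0 ((a, b), (den, [h11, h12, h13, h22, h23, h33])) N s))).getD
        ((i : ℕ) * 3 + j) 0 : ℤ) : ℝ) -
      2 ^ N * embMatrix (t1 a b) (t2 a b) ((2 : ℝ) ^ s) den [h11, h12, h13, h22, h23, h33] i j| ≤
      6 * 2 ^ s.natAbs * h * (a * b) := by
  have hT1 := nthRoot_scaled_bounds (a * b ^ 2) N
  have hT2 := nthRoot_scaled_bounds (a ^ 2 * b) N
  have hS3 := sqrt_three_scaled_bounds N
  change ((Nat.nthRoot 3 (a * b ^ 2 * 8 ^ N) : ℤ) : ℝ) ≤ t1 a b * 2 ^ N ∧ t1 a b * 2 ^ N < _ + 1 at hT1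
  change ((Nat.nthRoot 3 (a ^ 2 * b * 8 ^ N) : ℤ) : ℝ) ≤ t2 a b * 2 ^ N ∧ t2 a b * 2 ^ N < _ + 1 at hT2
  change ((Nat.sqrt (3 * 4 ^ N) : ℤ) : ℝ) ≤ _ ∧ _ < ((Nat.sqrt (3 * 4 ^ N) : ℤ) : ℝ) + 1 at hS3
  have hT : (2 : ℝ) ≤ a * b := by exact_mod_cast hab2
  have h0 : |((0 : ℤ) : ℝ)| ≤ h := by simpa using zero_le_one.trans hh
  have r1 := row_err hT1 hT2 hS3 (t1_nonneg a b) (t2_nonneg a b) (t1_le ha hb) (t2_le ha hb) hT hh s hden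
    h11 h12 h13 b12 b13
  have r2 := row_err hT1 hT2 hS3 (t1_nonneg a b) (t2_nonneg a b) (t1_le ha hb) (t2_le ha hb) hT hh s hden
    0 h22 h23 b22 b23
  have r3 := row_err hT1 hT2 hS3 (t1_nonneg a b) (t2_nonneg a b) (t1_le ha hb) (t2_le ha hb) hT hh s hden
    0 0 h33 h0 b33
  exact entries_to_matrix _ _ _ _ _ _ _ _ _ _ (bt_eq a b den h11 h12 h13 h22 h23 h33 N s hsN) _ _ _ _ _ _ _ _ _ _ _ _
    r1.1 r1.2.1 r1.2.2 r2.1 r2.2.1 r2.2.2 r3.1 r3.2.1 r3.2.2 i j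

end PureCubicLexMin

end Literature.NumberTheory.CubicFields

end
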